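import Mathlib

/-!
# Conditional window counting (stub `stub_condCount`)

The stub `stub_condCount` of the crux `MobiusLadder.QuadraticDigitPhases`
(stmt-QuantumAdvantage-1391), line `Sketch`, with its lemmas.  Mathlib only, no number theory.

Setting: `d` Boolean events `F j` on inputs `T < 2^N`; `F j` depends only on the bits of `T` at
positions `≤ top j`; the tops increase with gaps `> k`; and for every input, re-setting the window of
`k + 1` bits `[top j - k, top j]` in all `2^(k+1)` ways satisfies `F j` at most `(1 - c) 2^(k+1)`
times.  Conclusion: at most `(1 - c)^d 2^N` inputs satisfy all `F j`.

Proof: induction on `d`, peeling off the last (highest) event.  The inductive step is the abstract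
lemma `window_count`: write `T = hi·M·B + w·B + lo` (`B = 2^(top - k)`, `M = 2^(k+1)`), group the
inputs by the window-zeroed input `hi·M·B + lo`; on each group the earlier events are constant
(they only see `lo`), and the last event holds for at most `(1 - c) M` of the `M` members.
-/

set_option linter.dupNamespace false -- D-0017: single-problem summit ⇒ `QuantumAdvantage.QuantumAdvantage` by design

namespace Summit.QuantumAdvantage.QuantumAdvantage.Theorems.MobiusLadderQuadraticDigitPhasesStubCondCount

open Finset

/-- Two-level digit decomposition of `T` in base `B` then `M`:
`T = hi·M·B + w·B + lo` with `hi = T/B/M`, `w = T/B mod M`, `lo = T mod B`. -/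
theorem digit_decomp (T B M : ℕ) : T / B / M * M * B + T / B % M * B + T % B = T := by
  calc T / B / M * M * B + T / B % M * B + T % B
      = B * (M * (T / B / M) + T / B % M) + T % B := by ring
    _ = T := by rw [Nat.div_add_mod, Nat.div_add_mod]

/-- Zeroing the window: `T - w·B = hi·M·B + lo`. -/
theorem sub_window (T B M : ℕ) : T - T / B % M * B = T / B / M * M * B + T % B := by
  have := digit_decomp T B M
  omega

/-- Zeroing the window and putting it back gives `T`. -/
theorem sub_window_add (T B M : ℕ) : T - T / B % M * B + T / B % M * B = T := by
  have := digit_decomp T B M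
  omega

/-- The middle digit of `hi·M·B + lo + w·B` is `w`. -/
theorem member_div_mod {B M : ℕ} (hi lo w : ℕ) (hlo : lo < B) (hw : w < M) :
    (hi * M * B + lo + w * B) / B % M = w := by
  have hB : 0 < B := by omega
  rw [show hi * M * B + lo + w * B = B * (hi * M + w) + lo by ring, Nat.mul_add_div hB,
    Nat.div_eq_of_lt hlo, add_zero, Nat.mul_add_mod', Nat.mod_eq_of_lt hw]

/-- Members of a window group stay below `H·M·B` when the high digit is below `H`. -/
theorem member_lt {B M : ℕ} (hi lo w H : ℕ) (hlo : lo < B) (hw : w < M) (hh : hi < H) :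
    hi * M * B + lo + w * B < H * M * B := by
  have h1 : lo + w * B < M * B :=
    calc lo + w * B < B + w * B := by omega
      _ = (w + 1) * B := by ring
      _ ≤ M * B := Nat.mul_le_mul_right _ hw
  calc hi * M * B + lo + w * B = hi * M * B + (lo + w * B) := by ring
    _ < hi * M * B + M * B := by omega
    _ = (hi + 1) * (M * B) := by ring
    _ ≤ H * (M * B) := Nat.mul_le_mul_right _ hh
    _ = H * M * B := by ring

/-- Adding a multiple of `B` does not change residues modulo a divisor of `B`. -/
theorem add_mul_mod_of_dvd (Z w B D : ℕ) (hD : D ∣ B) : (Z + w * B) % D = Z % D := by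
  obtain ⟨e, rfl⟩ := hD
  rw [show Z + w * (D * e) = Z + D * (w * e) by ring, Nat.add_mul_mod_self_left]

/-- The high digit of `T < H·M·B` is below `H`. -/
theorem div_div_lt {B M : ℕ} (T H : ℕ) (hB : 0 < B) (hM : 0 < M) (hT : T < H * M * B) :
    T / B / M < H := by
  rw [Nat.div_lt_iff_lt_mul hM, Nat.div_lt_iff_lt_mul hB]
  exact hT

/-- **Window counting.**  Let `P` be invariant under adding multiples of `B`, and suppose that for
every input `T`, re-setting its middle digit `w = T/B mod M` in all `M` ways satisfies `Q` at most
`(1 - c) M` times.  Then `#{T < HMB : P T ∧ Q T} ≤ (1 - c) · #{T < HMB : P T}`. -/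
theorem window_count (B M H : ℕ) (hB : 0 < B) (hM : 0 < M) (c : ℝ) (P Q : ℕ → Prop)
    [DecidablePred P] [DecidablePred Q] (hP : ∀ Z w, P (Z + w * B) ↔ P Z)
    (hQ : ∀ T, (((range M).filter (fun w => Q (T - T / B % M * B + w * B))).card : ℝ) ≤
      (1 - c) * M) :
    (((range (H * M * B)).filter (fun T => P T ∧ Q T)).card : ℝ) ≤
      (1 - c) * ((range (H * M * B)).filter P).card := by
  have hMr : (0 : ℝ) < M := by exact_mod_cast hM
  have hc : 0 ≤ 1 - c := nonneg_of_mul_nonneg_left ((Nat.cast_nonneg _).trans (hQ 0)) hMr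
  set S := (range (H * M * B)).filter (fun T => P T ∧ Q T) with hS
  set X := (range (H * M * B)).filter P with hX
  set t := (range (H * M * B)).image (fun T => T - T / B % M * B) with ht
  have hSt : Set.MapsTo (fun T => T - T / B % M * B) (S : Set ℕ) (t : Set ℕ) := fun T hT =>
    mem_image_of_mem _ (mem_filter.1 (mem_coe.1 hT)).1
  have hXt : Set.MapsTo (fun T => T - T / B % M * B) (X : Set ℕ) (t : Set ℕ) := fun T hT =>
    mem_image_of_mem _ (mem_filter.1 (mem_coe.1 hT)).1
  rw [card_eq_sum_card_fiberwise hSt, card_eq_sum_card_fiberwise hXt, Nat.cast_sum, Nat.cast_sum,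
    mul_sum]
  refine sum_le_sum fun T' hT' => ?_
  simp only [ht, mem_image, mem_range] at hT'
  obtain ⟨T₀, hT₀, rfl⟩ := hT'
  have hlo : T₀ % B < B := Nat.mod_lt _ hB
  have hhi : T₀ / B / M < H := div_div_lt T₀ H hB hM hT₀
  have hg0 : T₀ - T₀ / B % M * B = T₀ / B / M * M * B + T₀ % B := sub_window T₀ B M
  have hz : (T₀ - T₀ / B % M * B) / B % M = 0 := by
    have := member_div_mod (T₀ / B / M) (T₀ % B) 0 hlo hM
    rw [zero_mul, add_zero] at this
    rw [hg0]
    exact this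
  by_cases hA : P (T₀ - T₀ / B % M * B)
  · have h1 : ((S.filter (fun T => T - T / B % M * B = T₀ - T₀ / B % M * B)).card : ℝ) ≤
        (1 - c) * M := by
      refine le_trans (Nat.cast_le.2 (card_le_card_of_injOn (fun T => T / B % M) ?_ ?_))
        (hQ (T₀ - T₀ / B % M * B))
      · intro T hT
        rw [mem_coe, mem_filter, hS, mem_filter] at hT
        obtain ⟨⟨-, -, hTQ⟩, hTg⟩ := hT
        simp only [mem_coe, mem_filter, mem_range]
        refine ⟨Nat.mod_lt _ hM, ?_⟩
        rw [hz, zero_mul, Nat.sub_zero, ← hTg, sub_window_add]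
        exact hTQ
      · intro T₁ hT₁ T₂ hT₂ hw
        rw [mem_coe, mem_filter] at hT₁ hT₂
        have hw' : T₁ / B % M * B = T₂ / B % M * B := by
          rw [show T₁ / B % M = T₂ / B % M from hw]
        have e₁ := sub_window_add T₁ B M
        have e₂ := sub_window_add T₂ B M
        have g₁ := hT₁.2
        have g₂ := hT₂.2
        omega
    have h2 : (M : ℝ) ≤ (X.filter (fun T => T - T / B % M * B = T₀ - T₀ / B % M * B)).card := by
      have hA' := hA
      rw [hg0] at hA'
      have hinj : Function.Injective (fun w => T₀ - T₀ / B % M * B + w * B) := by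
        intro w₁ w₂ h
        exact Nat.eq_of_mul_eq_mul_right hB (Nat.add_left_cancel h)
      have hsub : (range M).image (fun w => T₀ - T₀ / B % M * B + w * B) ⊆
          X.filter (fun T => T - T / B % M * B = T₀ - T₀ / B % M * B) := by
        intro x hx
        obtain ⟨w, hw, rfl⟩ := mem_image.1 hx
        rw [mem_range] at hw
        rw [mem_filter, hX, mem_filter, mem_range, hP, hg0, member_div_mod _ _ _ hlo hw,
          Nat.add_sub_cancel]
        exact ⟨⟨member_lt _ _ _ _ hlo hw hhi, hA'⟩, rfl⟩
      calc (M : ℝ) = ((range M).image (fun w => T₀ - T₀ / B % M * B + w * B)).card := by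
            rw [card_image_of_injective _ hinj, card_range]
        _ ≤ _ := by exact_mod_cast card_le_card hsub
    calc _ ≤ (1 - c) * M := h1
      _ ≤ _ := mul_le_mul_of_nonneg_left h2 hc
  · have hempty : S.filter (fun T => T - T / B % M * B = T₀ - T₀ / B % M * B) = ∅ := by
      rw [filter_eq_empty_iff]
      intro T hT hTg
      rw [hS, mem_filter] at hT
      apply hA
      rw [← hTg, ← hP _ (T / B % M), sub_window_add]
      exact hT.2.1
    rw [hempty, card_empty, Nat.cast_zero]
    exact mul_nonneg hc (Nat.cast_nonneg _)

/-- **Conditional window counting.**  `d` Boolean events `F j` on inputs `T < 2^N`, `F j` depending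
only on the bits at positions `≤ top j`, tops increasing with gaps `> k`, and for every input at
most a `(1 - c)`-fraction of the `2^(k+1)` re-settings of the window bits `[top j - k, top j]`
satisfying `F j`: then at most `(1 - c)^d 2^N` inputs satisfy every `F j`. -/
theorem stub_condCount :
    ∀ (N d k : ℕ) (c : ℝ) (top : Fin d → ℕ) (F : Fin d → ℕ → Bool),
      (∀ j, k ≤ top j ∧ top j < N) → (∀ i j : Fin d, i < j → top i + k < top j) →
      (∀ j, ∀ T T' : ℕ, T % 2 ^ (top j + 1) = T' % 2 ^ (top j + 1) → F j T = F j T') →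
      (∀ j, ∀ T : ℕ, (((Finset.range (2 ^ (k + 1))).filter (fun w =>
          F j (T - (T / 2 ^ (top j - k) % 2 ^ (k + 1)) * 2 ^ (top j - k) + w * 2 ^ (top j - k)) = true)).card : ℝ) ≤
          (1 - c) * (2 : ℝ) ^ (k + 1)) →
      (((Finset.range (2 ^ N)).filter (fun T => ∀ j, F j T = true)).card : ℝ) ≤ (1 - c) ^ d * (2 : ℝ) ^ N := by
  intro N d k c
  induction d with
  | zero =>
    intro top F _ _ _ _
    rw [pow_zero, one_mul]
    calc (((range (2 ^ N)).filter (fun T => ∀ j, F j T = true)).card : ℝ)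
        ≤ ((range (2 ^ N)).card : ℝ) := by exact_mod_cast card_filter_le _ _
      _ = 2 ^ N := by rw [card_range, Nat.cast_pow, Nat.cast_ofNat]
  | succ d ih =>
    intro top F h1 h2 h3 h4
    obtain ⟨hk, hN⟩ := h1 (Fin.last d)
    have hc : 0 ≤ 1 - c :=
      nonneg_of_mul_nonneg_left ((Nat.cast_nonneg _).trans (h4 (Fin.last d) 0)) (by positivity)
    have ih' := ih (fun i => top i.castSucc) (fun i => F i.castSucc) (fun j => h1 _)
      (fun i j hij => h2 _ _ (Fin.castSucc_lt_castSucc_iff.2 hij)) (fun j => h3 _)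
      (fun j => h4 _)
    have hB : 0 < 2 ^ (top (Fin.last d) - k) := by positivity
    have hM : 0 < 2 ^ (k + 1) := by positivity
    have hpow : 2 ^ (N - (top (Fin.last d) + 1)) * 2 ^ (k + 1) * 2 ^ (top (Fin.last d) - k) =
        2 ^ N := by
      rw [← pow_add, ← pow_add]
      congr 1
      omega
    have key : (((range (2 ^ N)).filter (fun T => (∀ i : Fin d, F i.castSucc T = true) ∧
        F (Fin.last d) T = true)).card : ℝ) ≤
        (1 - c) * ((range (2 ^ N)).filter (fun T => ∀ i : Fin d, F i.castSucc T = true)).card := by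
      rw [← hpow]
      refine window_count (2 ^ (top (Fin.last d) - k)) (2 ^ (k + 1))
        (2 ^ (N - (top (Fin.last d) + 1))) hB hM c (fun T => ∀ i : Fin d, F i.castSucc T = true)
        (fun T => F (Fin.last d) T = true) (fun Z w => forall_congr' fun i => ?_) (fun T => ?_)
      · have hi : top i.castSucc + 1 ≤ top (Fin.last d) - k := by
          have := h2 i.castSucc (Fin.last d) (Fin.castSucc_lt_last i)
          omega
        rw [h3 i.castSucc (Z + w * 2 ^ (top (Fin.last d) - k)) Z
          (add_mul_mod_of_dvd Z w _ _ (Nat.pow_dvd_pow 2 hi))]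
      · have := h4 (Fin.last d) T
        rw [Nat.cast_pow, Nat.cast_ofNat]
        exact this
    have hfilter : (range (2 ^ N)).filter (fun T => ∀ j, F j T = true) =
        (range (2 ^ N)).filter (fun T => (∀ i : Fin d, F i.castSucc T = true) ∧
          F (Fin.last d) T = true) :=
      filter_congr (fun T _ => Fin.forall_fin_succ')
    rw [hfilter]
    calc _ ≤ _ := key
      _ ≤ (1 - c) * ((1 - c) ^ d * 2 ^ N) := mul_le_mul_of_nonneg_left ih' hc
      _ = (1 - c) ^ (d + 1) * 2 ^ N := by ring

end Summit.QuantumAdvantage.QuantumAdvantage.Theorems.MobiusLadderQuadraticDigitPhasesStubCondCount
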